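import Mathlib
import Literature.NumberTheory.Transcendental.GammaFields
import Summits.Schanuel.Schanuel.Theorems.RigidCoreAclSubsetLogFreeCoreDoubleModelTransport

/-!
# Strongness bookkeeping for the countable model over the double

Support file for stub `stub_doubleModel` of line `eac-extends-core-automorphisms` (crux
`RigidCore.AclSubsetLogFreeCore`, stmt-Schanuel-0968).  Elementary consequences of Bays–Kirby's
predimension calculus (`GammaFields.lean`: addition formula `predim_add`, submodularity
`predim_sup_le`) used to establish, inside Bays–Kirby's countable model `M` of the double
`(K, D, θ)`, that the first copy `S₁ = ιM(j₁ W)` is strong and that the second copy has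
predimension `0` over it:

* `isStrong_of_forall_predim_nonneg_of_le`: `Λ ◁ M` as soon as `Λ ≤ H ◁ M` and `δ(V/Λ) ≥ 0` for
  the intermediate `Λ ≤ V ≤ H` (the hull argument of Bays–Kirby Lemma 4.5);
* `predim_sup_le_zero`: the submodularity estimate bounding `δ(W₂ + S₁ / S₁)` by
  `δ(W₂/X₁) - δ(W₂ ∩ S₁/X₁)`;
* `predim_map_nonneg_of_relRank`: the internal strongness clause of stub `stub_doubleBase`
  (stated in `K` with the algebraic matroid and `θ`) transported along `ιM : K →+* M`;
* `forall_predim_nonneg_map`: non-negativity of predimensions over a subspace of a subfield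
  `A` is independent of the exponential field in which `A` is embedded (two-target transport).

Everything is elementary and fully proved. [folklore]
-/

noncomputable section

-- `Summit.Schanuel.Schanuel.…` is the single-problem-summit namespace by design (D-0017).
set_option linter.dupNamespace false

open Set
open Literature.ModelTheory.ExponentialFields Literature.ModelTheory.ExponentialFields.ExponentialRing
open Literature.NumberTheory.Transcendental Literature.NumberTheory.Transcendental.GammaField

namespace Summit.Schanuel.Schanuel.Theorems.RigidCore

/-! ### One-field predimension estimates -/

section OneField

variable {E : Type*} [Field E] [CharZero E] [ExponentialRing E]

/-- **Strong inside a strong subspace is strong** (the hull argument, Bays–Kirby 2018 Lemma 4.5):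
if `H ◁ E`, `Λ ≤ H` and `δ(V/Λ) ≥ 0` for all finitely generated `Λ ≤ V ≤ H`, then `Λ ◁ E`.
For `Y ⊇ Λ`: `δ(Y/Λ) = δ(Y/Y ∩ H) + δ(Y ∩ H/Λ) ≥ δ(Y + H/H) + 0 ≥ 0`.
[cite: BaysKirby2018ANT, Lemma 4.5] -/
theorem isStrong_of_forall_predim_nonneg_of_le {Λ H : Submodule ℚ E} (hH : IsStrong H)
    (hΛH : Λ ≤ H)
    (h : ∀ V : Submodule ℚ E, Λ ≤ V → V ≤ H → IsFG Λ V → 0 ≤ predim Λ V) : IsStrong Λ := by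
  intro Y hΛY hfg
  have h1 : Λ ≤ Y ⊓ H := le_inf hΛY hΛH
  have hadd := predim_add h1 inf_le_left hfg
  have hsecond : 0 ≤ predim Λ (Y ⊓ H) := h _ h1 inf_le_right (hfg.mono inf_le_left)
  have hfgYH : IsFG (Y ⊓ H) Y := hfg.of_le_left h1
  have hsub : predim H (Y ⊔ H) ≤ predim (Y ⊓ H) Y := predim_sup_le Y H hfgYH
  have hHY : 0 ≤ predim H (Y ⊔ H) :=
    hH le_sup_right (isFG_sup_right.2 ((isFG_iff_isFG_inf Y H).2 hfgYH))
  linarith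

/-- **Submodularity estimate**: if `X₁ ≤ S₁`, `X₁ ≤ W₂` with `δ(W₂/X₁) ≤ 0` and `δ(V/X₁) ≥ 0` for
all `X₁ ≤ V ≤ S₁`, then `δ(S₁ + W₂/S₁) ≤ 0`: indeed
`δ(W₂ + S₁/S₁) ≤ δ(W₂/W₂ ∩ S₁) = δ(W₂/X₁) - δ(W₂ ∩ S₁/X₁)`. [cite: BaysKirby2018ANT, Lemma 4.2] -/
theorem predim_sup_le_zero {X₁ S₁ W₂ : Submodule ℚ E} (hXS : X₁ ≤ S₁) (hXW : X₁ ≤ W₂)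
    (hfg : IsFG X₁ W₂) (hδ : predim X₁ W₂ ≤ 0)
    (hX : ∀ V : Submodule ℚ E, X₁ ≤ V → V ≤ S₁ → IsFG X₁ V → 0 ≤ predim X₁ V) :
    predim S₁ (S₁ ⊔ W₂) ≤ 0 := by
  rw [sup_comm]
  have h1 : X₁ ≤ W₂ ⊓ S₁ := le_inf hXW hXS
  have hfg' : IsFG (W₂ ⊓ S₁) W₂ := hfg.of_le_left h1
  have hsub := predim_sup_le W₂ S₁ hfg'
  have hadd := predim_add h1 inf_le_left hfg
  have h0 := hX _ h1 inf_le_right (hfg.mono inf_le_left)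
  linarith

end OneField

/-! ### Pulling subspaces back along an embedding -/

section Pullback

variable {A : Type*} [Field A] [Module ℚ A]
variable {E : Type*} [Field E] [CharZero E]
variable (ι : A →+* E) (f : A →ₗ[ℚ] E) (hf : ∀ x, f x = ι x)

include hf in
/-- A subspace of `E` below `Ω.map f` is the image of its preimage. [folklore] -/
theorem map_comap_eq_of_le_map {Ω : Submodule ℚ A} {V' : Submodule ℚ E} (hV' : V' ≤ Ω.map f) :
    (V'.comap f).map f = V' := by
  refine le_antisymm (Submodule.map_comap_le f V') fun y hy => ?_
  obtain ⟨x, -, rfl⟩ := (mem_map_iff_of_eq ι f hf).1 (hV' hy)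
  refine Submodule.mem_map.2 ⟨x, ?_, hf x⟩
  rw [Submodule.mem_comap, hf]
  exact hy

include hf in
/-- The preimage of a subspace below `Ω.map f` lies below `Ω`. [folklore] -/
theorem comap_le_of_le_map {Ω : Submodule ℚ A} {V' : Submodule ℚ E} (hV' : V' ≤ Ω.map f) :
    V'.comap f ≤ Ω := fun x hx => by
  rw [Submodule.mem_comap, hf] at hx
  exact (apply_mem_map_iff ι f hf).1 (hV' hx)

/-- `Λ ≤ V'.comap f` as soon as `Λ.map f ≤ V'`. [folklore] -/
theorem le_comap_of_map_le {Λ : Submodule ℚ A} {V' : Submodule ℚ E} (hΛ : Λ.map f ≤ V') :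
    Λ ≤ V'.comap f := fun x hx => by
  rw [Submodule.mem_comap]
  exact hΛ (Submodule.mem_map_of_mem hx)

end Pullback

/-! ### The internal strongness clause transported along `ιM : K →+* M` -/

section Internal

variable {K : Type*} [Field K] [CharZero K]
variable {M : Type*} [Field M] [CharZero M] [ExponentialRing M]

/-- **Internal strongness passes to the model.** If `exp ∘ ι = ι ∘ θ` on `D`, `L ≤ D`, and for
every `L ≤ V ≤ D` the relative linear dimension `ldim(V/L)` is at most the relative algebraic
rank of `V ∪ θV` over `L ∪ θL` in `K`, then `δ(V'/ι L) ≥ 0` for every finitely generated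
`ι L ≤ V' ≤ ι D` in `M`. [folklore] -/
theorem predim_map_nonneg_of_relRank (ι : K →+* M) (f : K →ₗ[ℚ] M) (hf : ∀ x, f x = ι x)
    (θ : K → K) {D L : Submodule ℚ K} (hexp : ∀ x ∈ D, exp (ι x) = ι (θ x)) (hLD : L ≤ D)
    (hstrong : ∀ V : Submodule ℚ K, L ≤ V → V ≤ D →
      ((ldim L V : ℕ) : ℕ∞) ≤ (algMatroid K).relRank (↑L ∪ θ '' ↑L) (↑V ∪ θ '' ↑V))
    {V' : Submodule ℚ M} (hLV' : L.map f ≤ V') (hV'D : V' ≤ D.map f)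
    (hfg : IsFG (L.map f) V') : 0 ≤ predim (L.map f) V' := by
  have hVeq := map_comap_eq_of_le_map ι f hf hV'D
  have hLV : L ≤ V'.comap f := le_comap_of_map_le f hLV'
  have hVD : V'.comap f ≤ D := comap_le_of_le_map ι f hf hV'D
  have hcL : ∀ x ∈ L, exp (ι x) = ι (θ x) := fun x hx => hexp x (hLD hx)
  have hcV : ∀ x ∈ V'.comap f, exp (ι x) = ι (θ x) := fun x hx => hexp x (hVD hx)
  rw [← hVeq] at hfg ⊢
  rw [predim_map_map ι f hf θ hcL hcV]
  have hne : td (L.map f) ((V'.comap f).map f) ≠ ⊤ := td_ne_top hfg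
  rw [td_map_map ι f hf θ hcL hcV] at hne
  have h1 := hstrong _ hLV hVD
  rw [← ENat.coe_toNat hne, Nat.cast_le] at h1
  have h2 := Int.ofNat_le.2 h1
  linarith

end Internal

/-! ### Non-negativity of predimensions does not depend on the ambient exponential field -/

section TwoTargets

variable {A : Type*} [Field A] [Module ℚ A] [CharZero A]
variable {E₁ : Type*} [Field E₁] [CharZero E₁] [ExponentialRing E₁]
variable {E₂ : Type*} [Field E₂] [CharZero E₂] [ExponentialRing E₂]

/-- **Two-target transport of internal strongness.** If `ι₁, ι₂` both intertwine `ex` with `exp`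
on `Ω ≥ Λ` and `δ(V/ι₂ Λ) ≥ 0` for all finitely generated `V ≥ ι₂ Λ` in `E₂`, then
`δ(V'/ι₁ Λ) ≥ 0` for all finitely generated `ι₁ Λ ≤ V' ≤ ι₁ Ω` in `E₁`. [folklore] -/
theorem forall_predim_nonneg_map (ι₁ : A →+* E₁) (f₁ : A →ₗ[ℚ] E₁) (hf₁ : ∀ x, f₁ x = ι₁ x)
    (ι₂ : A →+* E₂) (f₂ : A →ₗ[ℚ] E₂) (hf₂ : ∀ x, f₂ x = ι₂ x) (ex : A → A)
    {Λ Ω : Submodule ℚ A} (hΛΩ : Λ ≤ Ω)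
    (h₁ : ∀ x ∈ Ω, exp (ι₁ x) = ι₁ (ex x)) (h₂ : ∀ x ∈ Ω, exp (ι₂ x) = ι₂ (ex x))
    (h : ∀ V : Submodule ℚ E₂, Λ.map f₂ ≤ V → IsFG (Λ.map f₂) V → 0 ≤ predim (Λ.map f₂) V)
    {V' : Submodule ℚ E₁} (hΛV' : Λ.map f₁ ≤ V') (hV'Ω : V' ≤ Ω.map f₁)
    (hfg : IsFG (Λ.map f₁) V') : 0 ≤ predim (Λ.map f₁) V' := by
  have hVeq := map_comap_eq_of_le_map ι₁ f₁ hf₁ hV'Ω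
  have hΛV : Λ ≤ V'.comap f₁ := le_comap_of_map_le f₁ hΛV'
  have hVΩ : V'.comap f₁ ≤ Ω := comap_le_of_le_map ι₁ f₁ hf₁ hV'Ω
  rw [← hVeq] at hfg ⊢
  rw [predim_map_eq_predim_map ι₁ f₁ hf₁ ι₂ f₂ hf₂ ex (fun x hx => h₁ x (hΛΩ hx))
    (fun x hx => h₁ x (hVΩ hx)) (fun x hx => h₂ x (hΛΩ hx)) (fun x hx => h₂ x (hVΩ hx))]
  exact h _ (Submodule.map_mono hΛV)
    ((isFG_map_iff_isFG_map ι₁ f₁ hf₁ ι₂ f₂ hf₂ Λ _).1 hfg)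

/-- **Two-target transport of a predimension value** along `Λ ≤ Λ' ≤ Ω`. [folklore] -/
theorem predim_map_eq_of_le (ι₁ : A →+* E₁) (f₁ : A →ₗ[ℚ] E₁) (hf₁ : ∀ x, f₁ x = ι₁ x)
    (ι₂ : A →+* E₂) (f₂ : A →ₗ[ℚ] E₂) (hf₂ : ∀ x, f₂ x = ι₂ x) (ex : A → A)
    {Λ Λ' Ω : Submodule ℚ A} (hΛΩ : Λ ≤ Ω) (hΛ'Ω : Λ' ≤ Ω)
    (h₁ : ∀ x ∈ Ω, exp (ι₁ x) = ι₁ (ex x)) (h₂ : ∀ x ∈ Ω, exp (ι₂ x) = ι₂ (ex x)) :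
    predim (Λ.map f₁) (Λ'.map f₁) = predim (Λ.map f₂) (Λ'.map f₂) :=
  predim_map_eq_predim_map ι₁ f₁ hf₁ ι₂ f₂ hf₂ ex (fun x hx => h₁ x (hΛΩ hx))
    (fun x hx => h₁ x (hΛ'Ω hx)) (fun x hx => h₂ x (hΛΩ hx)) (fun x hx => h₂ x (hΛ'Ω hx))

end TwoTargets

/-- Registered sub-goal alias (for `--supports stmt-Schanuel-0968`): strong inside a strong
subspace is strong (Bays–Kirby 2018 Lemma 4.5). -/
theorem doubleModel_isStrong_of_forall_predim_nonneg_of_le {E : Type*} [Field E] [CharZero E]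
    [ExponentialRing E] {Λ H : Submodule ℚ E} (hH : IsStrong H) (hΛH : Λ ≤ H)
    (h : ∀ V : Submodule ℚ E, Λ ≤ V → V ≤ H → IsFG Λ V → 0 ≤ predim Λ V) : IsStrong Λ :=
  isStrong_of_forall_predim_nonneg_of_le hH hΛH h

end Summit.Schanuel.Schanuel.Theorems.RigidCore
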